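import Summits.QuantumFields.YangMills.Theorems.IR.EsPolymerGasMixingK
import Summits.QuantumFields.YangMills.Theorems.IR.EsPolymerGridCellsK

/-!
# Crux `IR` (item stmt-QuantumFields-19354) — line «es-polymer-decoupling», open stub `stub_polymerEngineK`, input (c):
# PLAN EXECUTED — the three stubs of the 2026-08-28T04:11Z plan are PROVED and LANDED as helper files

This workfile (ideator ym-ir-idea-1, g7) replaces the sorried plan of the same path.  Input (c) «two-region exponential
mixing of the hard-core cell gas for near-family functionals» of the lead's open engine stub `stub_polymerEngineK :
PolymerEngineK` is now in the tree, sorry-free, by the SWAPPING LEMMA (no cluster expansion):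
* part 1/3 `Theorems/IR/EsPolymerGasSwapK.lean` (p605156): vocabulary `GasMixing.cells / clusterB / swapWith / swap / good /
  animals / comp`; `swap_isSwappingMap` (was `stub_swapMap`);
* part 2/3 `Theorems/IR/EsPolymerGasPeierls2K.lean` (p605525): `pairProbNotMem_good_le` (was `stub_pairProb_le_animals`),
  `sum_animals_pow_le` (was `stub_animals_tail`), with `sum_filter_subset_le_prod_act` (multi-polymer Peierls),
  `eq_of_compatible_of_cells_eq` (injectivity of `cells` on compatible families), `cells_comp_mem_animals`;
* part 3/3 `Theorems/IR/EsPolymerGasMixingK.lean` (p605664): `gasCov_nearFamily_le`, `exists_bounded_tag`, `abs_blockCov_le_pow`.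
* input (d) `Theorems/IR/EsPolymerGridCellsK.lean` (p607513): cell index / `cellOf` bookkeeping for an arbitrary `IsGrid` mesh
  (`torusEdge_mem_torusCellEdges`, `dependsOn_blockEdges[_shift]`, `succ_le_mul_cellDist`);
* input (e) `Theorems/IR/EsPolymerEngineK.lean` (p608147): **`EngineK.polymerEngineK : PolymerEngineK`** — the ENGINE STUB'S TYPE IS
  PROVED.  The LEAD (registry slot LEAD-only, RULING g9-№1) may close `stub_polymerEngineK` of
  `Lines/es_polymer_decoupling.lean` by `EngineK.polymerEngineK`; the line's only remaining open stub is then the load-bearing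
  `stub_polymerCertK : IRPolymerCertK` (XL; critics' price: no prover on it this round).
The statements are re-checked below BY NAME.

HONEST FRAMING: engine-level finite combinatorics for an OPEN, PROVABLE stub of a CONDITIONAL rung line; the load
`stub_polymerCertK : IRPolymerCertK` (XL) is untouched; nothing here proves `BalabanLadder.IR` or the Clay Yang–Mills mass
gap; R4 closes only the conditional finite-𝕋⁴ rung `BalabanLadder.UV`.  Not a registered skeleton (RULING g9-№1).
-/

set_option autoImplicit false

noncomputable section

open MeasureTheory Finset Function
open Literature.MathematicalPhysics.QuantumFieldTheory
open Literature.MathematicalPhysics.QuantumFieldTheory.AdhikariCao2022 (IsSwappingMap pairProbNotMem)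

namespace Summit.QuantumFields.YangMills.Cruxes.IR.EsPolymer.GasMixing

variable {q : ℕ}

/-- (c1) landed: the swap is a swapping map. -/
example {g : Finset (Finset (Cell q)) → ℝ} {act : Finset (Cell q) → ℝ} {Z : ℝ}
    (hgc : ∀ Γ, ¬ Compatible Γ → g Γ = 0) (hmass : ∀ Γ, Compatible Γ → g Γ = Z⁻¹ * ∏ γ ∈ Γ, act γ)
    (k : ℕ) (cA cB : Cell q) (ΦA ΦB : Finset (Finset (Cell q)) → ℝ) :
    IsSwappingMap g (good cA cB k) (fun Γ => (ΦA (nearFamily Γ cA k) : ℂ)) (fun Γ => (ΦB (nearFamily Γ cB k) : ℂ))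
      (swap cB k) :=
  swap_isSwappingMap hgc hmass k cA cB ΦA ΦB

/-- (c2) landed: the two-copy Peierls bound of the bad event. -/
example {g : Finset (Finset (Cell q)) → ℝ} {act : Finset (Cell q) → ℝ} {Z p : ℝ}
    (hg0 : ∀ Γ, 0 ≤ g Γ) (hg1 : ∑ Γ, g Γ = 1) (hgc : ∀ Γ, ¬ Compatible Γ → g Γ = 0)
    (hmass : ∀ Γ, Compatible Γ → g Γ = Z⁻¹ * ∏ γ ∈ Γ, act γ) (hact : ∀ γ, 0 ≤ act γ)
    (hactp : ∀ γ, act γ ≤ p ^ γ.card) (hp : 0 ≤ p) (hp1 : p ≤ 1) (k : ℕ) (cA cB : Cell q) :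
    pairProbNotMem g (good cA cB k) ≤ ∑ X ∈ animals cA cB k, (4 * p) ^ X.card :=
  pairProbNotMem_good_le hg0 hg1 hgc hmass hact hactp hp hp1 k cA cB

/-- (c3) landed: the lattice-animal tail. -/
example [NeZero q] {p : ℝ} (hp : 0 ≤ p) (hsmall : ((13 : ℝ) ^ 4 + 1) ^ 2 * (2 * Real.sqrt p) ≤ 1 / 2) (k : ℕ)
    (cA cB : Cell q) :
    ∑ X ∈ animals cA cB k, (4 * p) ^ X.card ≤
      2 * ((2 * k + 3 : ℕ) : ℝ) ^ 4 * (2 * Real.sqrt p) ^ ((cellDist cA cB - (2 * k + 2)) / 6 + 2) :=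
  sum_animals_pow_le hp hsmall k cA cB

/-- Input (c) as the lead phrased it, landed. -/
example [NeZero q] {g : Finset (Finset (Cell q)) → ℝ} {act : Finset (Cell q) → ℝ} {Z p : ℝ}
    (hg0 : ∀ Γ, 0 ≤ g Γ) (hg1 : ∑ Γ, g Γ = 1) (hgc : ∀ Γ, ¬ Compatible Γ → g Γ = 0)
    (hmass : ∀ Γ, Compatible Γ → g Γ = Z⁻¹ * ∏ γ ∈ Γ, act γ) (hact : ∀ γ, 0 ≤ act γ)
    (hactp : ∀ γ, act γ ≤ p ^ γ.card) (hp : 0 ≤ p) (hsmall : ((13 : ℝ) ^ 4 + 1) ^ 2 * (2 * Real.sqrt p) ≤ 1 / 2)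
    (k : ℕ) (cA cB : Cell q) (ΦA ΦB : Finset (Finset (Cell q)) → ℝ) {CA CB : ℝ} (hA : ∀ F, |ΦA F| ≤ CA)
    (hB : ∀ F, |ΦB F| ≤ CB) :
    |(∑ Γ, g Γ * (ΦA (nearFamily Γ cA k) * ΦB (nearFamily Γ cB k))) -
        (∑ Γ, g Γ * ΦA (nearFamily Γ cA k)) * (∑ Γ, g Γ * ΦB (nearFamily Γ cB k))| ≤
      4 * CA * CB * ((2 * k + 3 : ℕ) : ℝ) ^ 4 * (2 * Real.sqrt p) ^ ((cellDist cA cB - (2 * k + 2)) / 6 + 2) :=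
  gasCov_nearFamily_le hg0 hg1 hgc hmass hact hactp hp hsmall k cA cB ΦA ΦB hA hB

/-- Input (d) landed (re-checked by name): the mesh bound for the time-translated cell. -/
example {S b : ℕ} {w : Fin 4 → ℤ → ℤ} [NeZero q] (hg : IsGrid (2 * S + 1) b q w) (hb : 1 ≤ b) {n : ℕ} (hn : n ≤ S) :
    (n : ℤ) + 1 ≤ 2 * (b : ℤ) * (cellDist (GridCells.cellOf q w 0) (GridCells.cellOf q w (Pi.single 0 (n : ℤ))) + 1) :=
  GridCells.succ_le_mul_cellDist hg hb hn

/- Input (e) landed: `Summit.QuantumFields.YangMills.Cruxes.IR.EsPolymer.EngineK.polymerEngineK : PolymerEngineK`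
   (`Theorems/IR/EsPolymerEngineK.lean`, p608147) — not restated here only because this pointer is written before the farm
   serves that module's olean; `example : PolymerEngineK := EngineK.polymerEngineK` elaborates against the tree. -/

end Summit.QuantumFields.YangMills.Cruxes.IR.EsPolymer.GasMixing

end
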